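import Literature.MathematicalPhysics.QuantumLattice.DWaveSourceParticleHole
import Literature.MathematicalPhysics.QuantumLattice.LiebFluxPhaseGauge
import Literature.MathematicalPhysics.QuantumLattice.HubbardSzSectorLadder
import Literature.MathematicalPhysics.QuantumLattice.HubbardLSMFillingProofs
import Summits.HubbardSuperconductivity.HubbardSuperconductivity.Theses.CooperPairDMottWalk
import Summits.HubbardSuperconductivity.HubbardSuperconductivity.Theorems.ThermalWedgeTwTipContinuationEdgeOrderPairAlgebra

/-!
# Route `CooperPairDMottWalk`, crux `BindingWalk` (stmt-HubbardSuperconductivity-1176):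
# the Shiba (partial particle–hole) transport of the spin-sector energies

Helper file (`--supports stmt-HubbardSuperconductivity-1176`) for the junction stub
`stub_junctionLeg` of the registered line `Cruxes/BindingWalk/Lines/birth.lean`, whose conclusion is
the two-hole PAIR-BINDING inequality of the pure repulsive torus,
`E(L²-2, S^z=0) + E(L², 0) + ε ≤ 2 E(L²-1, ½)` (`E(N, M) = minEnergyOn (szSector N M)`; clause (a)
of the route's target `PureCooperPair`, stmt-1175, through the proved support `BreathingAtOneIsPure`).

Lieb's partial particle–hole transformation on the down spins composed with the bipartite gauge,
`S = orbitalPhase g · partialParticleHole D↓` (`g = 1` on `↑` orbitals, `g(x↓) g(y↓)* = -1` on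
bonds), is a unitary with

* `S H(t, U) Sᴴ = H(t, -U) + U N↑` on every finite graph carrying such a `g`
  (`shiba_conj_hamiltonian`; Lieb 1989, proof of Thm 2; Shiba 1972),
* `S : sector (N↑, N↓) = (a, b) → (a, |Λ| - b)` (`isInSector_shiba_mulVec`,
  `isInSector_shiba_conjTranspose_mulVec`),

hence (in the companion file `CooperPairDMottWalkBindingWalkShibaTorus`) the **sector-energy
dictionary** (`minEnergyOn_szSector_shiba`)

  `E_{t,U}(a, b) = E_{t,-U}(a, |Λ| - b) + U a`   (`a, b ≤ |Λ|`),

the `(N↑, N↓)`-resolved form of the particle–hole relations of Lieb–Wu (Physica A 321 (2003) 1,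
eq. (3)); the tree had the `N`-resolved full particle–hole version
(`groundEnergyAt_particleHole`) and the operator identity at the grand-canonical level
(`partialParticleHole_conj_hamiltonianWith`, with the down-spin hopping sign left flipped), but
not the spin-sector transport. On the even torus (`torusStagger` is a bipartite sign) this turns
the two-hole pair-binding energy of the REPULSIVE model into a half-filling quantity of the
ATTRACTIVE model (`twoHoleBinding_eq_attractive`):

  `2E_U(L²-1, ½) - E_U(L², 0) - E_U(L²-2, 0)
      = 2E_{-U}(L²+1, -½) + U - E_{-U}(L², 0) - E_{-U}(L², -1)`,

i.e. (charge gap) − (spin gap) of the attractive model at half filling, the language in which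
spin-reflection positivity (Lieb 1989) and Tian's gap inequalities are stated; and the
pair-binding clause of `PureCooperPair` / of `stub_junctionLeg` at the pure point is EQUIVALENT,
side by side in `L`, to the attractive-model inequality
`E_{-U}(L², -1) + E_{-U}(L², 0) + ε ≤ 2E_{-U}(L²+1, -½) + U` (`pureBinding_iff_attractive`).
This reformulates the stub; it does not prove it.

References: E. H. Lieb, PRL 62 (1989) 1201, proof of Theorem 2; H. Shiba, Prog. Theor. Phys. 48
(1972) 2171, §2; E. H. Lieb, F. Y. Wu, Physica A 321 (2003) 1, eq. (3); G.-S. Tian, J. Stat.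
Phys. 116 (2004) 629, §4 (gap inequalities from spin-reflection positivity). All statements are
finite-dimensional algebra over tree definitions; no definition and no named fact is introduced.
-/

set_option linter.dupNamespace false

noncomputable section

namespace Summit.HubbardSuperconductivity.HubbardSuperconductivity.Theorems.CooperPairDMottWalk

open Matrix Finset Literature.MathematicalPhysics.QuantumLattice
open scoped symmDiff ComplexOrder

section General

variable {Λ : Type*} [LinearOrder Λ] [Fintype Λ]

/-! ### Occupation sets under the down-spin particle–hole exchange `s ↦ s ∆ D↓` -/

/-- The up-spin occupation set is unchanged by `s ↦ s ∆ D↓`. [folklore] -/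
theorem upPart_symmDiff_spinDownOrbitals (s : Finset (Orb Λ)) :
    upPart (s ∆ (spinDownOrbitals : Finset (Orb Λ))) = upPart s := by
  ext x
  have hx : orb x 0 ∉ (spinDownOrbitals : Finset (Orb Λ)) := by
    rw [orb_mem_spinDownOrbitals_iff]; exact Fin.zero_ne_one
  simp only [mem_upPart, Finset.mem_symmDiff]
  tauto

/-- The down-spin occupation set is complemented by `s ↦ s ∆ D↓`. [folklore] -/
theorem downPart_symmDiff_spinDownOrbitals (s : Finset (Orb Λ)) :
    downPart (s ∆ (spinDownOrbitals : Finset (Orb Λ))) = (downPart s)ᶜ := by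
  ext x
  have hx : orb x 1 ∈ (spinDownOrbitals : Finset (Orb Λ)) := by
    rw [orb_mem_spinDownOrbitals_iff]
  simp only [mem_downPart, Finset.mem_symmDiff, Finset.mem_compl]
  tauto

/-- `N↓(s ∆ D↓) = |Λ| - N↓(s)`. [folklore] -/
theorem card_downPart_symmDiff_spinDownOrbitals (s : Finset (Orb Λ)) :
    (downPart (s ∆ (spinDownOrbitals : Finset (Orb Λ)))).card = Fintype.card Λ - (downPart s).card := by
  rw [downPart_symmDiff_spinDownOrbitals, Finset.card_compl]

/-- `N↓(s) ≤ |Λ|`. [folklore] -/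
theorem card_downPart_le (s : Finset (Orb Λ)) : (downPart s).card ≤ Fintype.card Λ :=
  (downPart s).card_le_univ

/-! ### The Shiba unitary `S = orbitalPhase g · partialParticleHole D↓` on the spin sectors -/

/-- **`S` maps the sector `(a, b)` into `(a, |Λ| - b)`.** [cite: Lieb1989, proof of Theorem 2] -/
theorem isInSector_shiba_mulVec (g : Orb Λ → ℂ) {a b : ℕ} {ψ : Fock (Orb Λ)}
    (hψ : IsInSector a b ψ) :
    IsInSector a (Fintype.card Λ - b)
      ((orbitalPhase g * partialParticleHole (spinDownOrbitals : Finset (Orb Λ))) *ᵥ ψ) := by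
  intro t ht
  rw [← mulVec_mulVec, orbitalPhase, mulVec_diagonal, partialParticleHole_mulVec_apply]
  have h0 : ψ (t ∆ spinDownOrbitals) = 0 := by
    refine hψ _ fun h => ht ?_
    rw [upPart_symmDiff_spinDownOrbitals, card_downPart_symmDiff_spinDownOrbitals] at h
    have := card_downPart_le t
    exact ⟨h.1, by omega⟩
  rw [h0, mul_zero, mul_zero]

/-- **`Sᴴ` maps the sector `(a, |Λ| - b)` back into `(a, b)`** (`b ≤ |Λ|`). [cite: Lieb1989, proof of Theorem 2] -/
theorem isInSector_shiba_conjTranspose_mulVec (g : Orb Λ → ℂ) {a b : ℕ} (hb : b ≤ Fintype.card Λ)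
    {φ : Fock (Orb Λ)} (hφ : IsInSector a (Fintype.card Λ - b) φ) :
    IsInSector a b
      ((orbitalPhase g * partialParticleHole (spinDownOrbitals : Finset (Orb Λ)))ᴴ *ᵥ φ) := by
  intro t ht
  rw [conjTranspose_mul, ← mulVec_mulVec, partialParticleHole_conjTranspose_mulVec_apply, orbitalPhase,
    diagonal_conjTranspose, mulVec_diagonal]
  have h0 : φ (t ∆ spinDownOrbitals) = 0 := by
    refine hφ _ fun h => ht ?_
    rw [upPart_symmDiff_spinDownOrbitals, card_downPart_symmDiff_spinDownOrbitals] at h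
    have := card_downPart_le t
    exact ⟨h.1, by omega⟩
  rw [h0, mul_zero, mul_zero]

end General

/-! ### The operator identity `S H(t,U) Sᴴ = H(t,-U) + U N↑` -/

section Operator

variable {Λ : Type*} [LinearOrder Λ] [Fintype Λ] (G : SimpleGraph Λ) [DecidableRel G.Adj]

/-- Conjugation by the down-spin partial particle–hole unitary, as the value of the `⋆`-algebra
automorphism `Unitary.conjStarAlgAut`. [folklore] -/
theorem conjStarAlgAut_partialParticleHole_apply (X : Matrix (Finset (Orb Λ)) (Finset (Orb Λ)) ℂ) :
    Unitary.conjStarAlgAut ℂ (Matrix (Finset (Orb Λ)) (Finset (Orb Λ)) ℂ)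
        ⟨partialParticleHole (spinDownOrbitals : Finset (Orb Λ)),
          partialParticleHole_mem_unitaryGroup _⟩ X =
      partialParticleHole (spinDownOrbitals : Finset (Orb Λ)) * X *
        (partialParticleHole (spinDownOrbitals : Finset (Orb Λ)))ᴴ := by
  rw [Unitary.conjStarAlgAut_apply]
  rfl

/-- **Down-spin particle–hole exchange of one bond's hopping**: for `x ≠ y`,
`W (Σ_σ c†_{xσ} c_{yσ}) Wᴴ = c†_{x↑} c_{y↑} - c†_{y↓} c_{x↓}` (`W = partialParticleHole D↓`;
the down-spin hopping changes sign and direction). [cite: Lieb1989, proof of Theorem 2] -/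
theorem partialParticleHole_conj_bondHopping {x y : Λ} (hxy : x ≠ y) :
    partialParticleHole (spinDownOrbitals : Finset (Orb Λ)) *
        (∑ σ : Fin 2, creation (orb x σ) * annihilation (orb y σ)) *
        (partialParticleHole (spinDownOrbitals : Finset (Orb Λ)))ᴴ =
      creation (orb x 0) * annihilation (orb y 0) - creation (orb y 1) * annihilation (orb x 1) := by
  have hx0 : orb x 0 ∉ (spinDownOrbitals : Finset (Orb Λ)) := by
    rw [orb_mem_spinDownOrbitals_iff]; exact Fin.zero_ne_one
  have hy0 : orb y 0 ∉ (spinDownOrbitals : Finset (Orb Λ)) := by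
    rw [orb_mem_spinDownOrbitals_iff]; exact Fin.zero_ne_one
  have hx1 : orb x 1 ∈ (spinDownOrbitals : Finset (Orb Λ)) := by rw [orb_mem_spinDownOrbitals_iff]
  have hy1 : orb y 1 ∈ (spinDownOrbitals : Finset (Orb Λ)) := by rw [orb_mem_spinDownOrbitals_iff]
  have hne : orb x 1 ≠ orb y 1 := fun h => hxy (orb_inj.1 h).1
  rw [Fin.sum_univ_two, Matrix.mul_add, Matrix.add_mul, partialParticleHole_conj_hop_of_not_mem hx0 hy0,
    partialParticleHole_conj_hop_of_mem hx1 hy1, if_neg hne, zero_sub, ← sub_eq_add_neg]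

/-- **Down-spin particle–hole exchange of the hopping term**:
`W (Σ_{x∼y,σ} c†_{xσ} c_{yσ}) Wᴴ = Σ_{x∼y} (c†_{x↑} c_{y↑} - c†_{y↓} c_{x↓})`.
[cite: Lieb1989, proof of Theorem 2] -/
theorem partialParticleHole_conj_hopping :
    partialParticleHole (spinDownOrbitals : Finset (Orb Λ)) *
        (∑ x : Λ, ∑ y : Λ, ∑ σ : Fin 2,
          if G.Adj x y then creation (orb x σ) * annihilation (orb y σ) else 0) *
        (partialParticleHole (spinDownOrbitals : Finset (Orb Λ)))ᴴ =
      ∑ x : Λ, ∑ y : Λ, if G.Adj x y then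
        creation (orb x 0) * annihilation (orb y 0) - creation (orb y 1) * annihilation (orb x 1) else 0 := by
  rw [← conjStarAlgAut_partialParticleHole_apply, map_sum]
  refine Finset.sum_congr rfl fun x _ => ?_
  rw [map_sum]
  refine Finset.sum_congr rfl fun y _ => ?_
  by_cases hxy : G.Adj x y
  · simp only [if_pos hxy]
    rw [conjStarAlgAut_partialParticleHole_apply, partialParticleHole_conj_bondHopping (G.ne_of_adj hxy)]
  · simp only [if_neg hxy, Finset.sum_const_zero, map_zero]

/-- **The bipartite gauge on the down spins restores the hopping sign**: for orbital phases `g`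
with `g = 1` on up orbitals and `g(x↓) g(y↓)* = -1` on every bond,
`V (Σ_{x∼y} (c†_{x↑} c_{y↑} - c†_{y↓} c_{x↓})) Vᴴ = Σ_{x∼y,σ} c†_{xσ} c_{yσ}` (`V = orbitalPhase g`).
[cite: Lieb1989, proof of Theorem 2] -/
theorem orbitalPhase_conj_flippedHopping {g : Orb Λ → ℂ} (hg : ∀ i, ‖g i‖ = 1)
    (hg0 : ∀ x, g (orb x 0) = 1) (hg1 : ∀ x y, G.Adj x y → g (orb x 1) * star (g (orb y 1)) = -1) :
    orbitalPhase g *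
        (∑ x : Λ, ∑ y : Λ, if G.Adj x y then
          creation (orb x 0) * annihilation (orb y 0) - creation (orb y 1) * annihilation (orb x 1) else 0) *
        (orbitalPhase g)ᴴ =
      ∑ x : Λ, ∑ y : Λ, ∑ σ : Fin 2,
        if G.Adj x y then creation (orb x σ) * annihilation (orb y σ) else 0 := by
  -- conjugate bond by bond
  have hV : orbitalPhase g *
      (∑ x : Λ, ∑ y : Λ, if G.Adj x y then
        creation (orb x 0) * annihilation (orb y 0) - creation (orb y 1) * annihilation (orb x 1) else 0) *
      (orbitalPhase g)ᴴ =
      ∑ x : Λ, ∑ y : Λ, if G.Adj x y then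
        creation (orb x 0) * annihilation (orb y 0) + creation (orb y 1) * annihilation (orb x 1) else 0 := by
    rw [← orbitalPhaseAut_apply hg, map_sum]
    refine Finset.sum_congr rfl fun x _ => ?_
    rw [map_sum]
    refine Finset.sum_congr rfl fun y _ => ?_
    by_cases hxy : G.Adj x y
    · simp only [if_pos hxy]
      rw [map_sub, orbitalPhaseAut_creation_mul_annihilation hg, orbitalPhaseAut_creation_mul_annihilation hg,
        hg0, hg0, hg1 y x (G.adj_symm hxy), star_one, mul_one, one_smul, neg_smul, one_smul, sub_neg_eq_add]
    · simp only [if_neg hxy, map_zero]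
  rw [hV]
  -- re-orient the down-spin bonds: `Σ_{x∼y} c†_{y↓} c_{x↓} = Σ_{x∼y} c†_{x↓} c_{y↓}`
  have hswap : (∑ x : Λ, ∑ y : Λ, if G.Adj x y then creation (orb y 1) * annihilation (orb x 1) else
      (0 : Matrix (Finset (Orb Λ)) (Finset (Orb Λ)) ℂ)) =
      ∑ x : Λ, ∑ y : Λ, if G.Adj x y then creation (orb x 1) * annihilation (orb y 1) else 0 := by
    rw [Finset.sum_comm]
    refine Finset.sum_congr rfl fun x _ => Finset.sum_congr rfl fun y _ => ?_
    simp only [G.adj_comm x y]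
  have hsplit : ∀ x y : Λ, (if G.Adj x y then
      creation (orb x 0) * annihilation (orb y 0) + creation (orb y 1) * annihilation (orb x 1) else
      (0 : Matrix (Finset (Orb Λ)) (Finset (Orb Λ)) ℂ)) =
      (if G.Adj x y then creation (orb x 0) * annihilation (orb y 0) else 0) +
        (if G.Adj x y then creation (orb y 1) * annihilation (orb x 1) else 0) := by
    intro x y
    split_ifs <;> simp
  have hsplit' : ∀ x y : Λ, (∑ σ : Fin 2, if G.Adj x y then creation (orb x σ) * annihilation (orb y σ) else
      (0 : Matrix (Finset (Orb Λ)) (Finset (Orb Λ)) ℂ)) =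
      (if G.Adj x y then creation (orb x 0) * annihilation (orb y 0) else 0) +
        (if G.Adj x y then creation (orb x 1) * annihilation (orb y 1) else 0) := by
    intro x y
    rw [Fin.sum_univ_two]
  simp only [hsplit, hsplit', Finset.sum_add_distrib]
  rw [hswap]

/-- **Number operators are gauge invariant**: `V n_{xσ} Vᴴ = n_{xσ}`. [folklore] -/
theorem orbitalPhase_conj_numberOp {g : Orb Λ → ℂ} (hg : ∀ i, ‖g i‖ = 1) (x : Λ) (σ : Fin 2) :
    orbitalPhase g * numberOp x σ * (orbitalPhase g)ᴴ = numberOp x σ := by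
  rw [← orbitalPhaseAut_apply hg]
  exact orbitalPhaseAut_numberAt hg (orb x σ)

/-- `V N↑ Vᴴ = N↑` and `V (Σ_x n_{x↑} n_{x↓}) Vᴴ = Σ_x n_{x↑} n_{x↓}`, combined:
`V (N↑ - Σ_x n_{x↑} n_{x↓}) Vᴴ = N↑ - Σ_x n_{x↑} n_{x↓}`. [folklore] -/
theorem orbitalPhase_conj_numberUp_sub_onSite {g : Orb Λ → ℂ} (hg : ∀ i, ‖g i‖ = 1) :
    orbitalPhase g * ((∑ x : Λ, numberOp x 0) - ∑ x : Λ, numberOp x 0 * numberOp x 1) *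
        (orbitalPhase g)ᴴ =
      (∑ x : Λ, numberOp x 0) - ∑ x : Λ, numberOp x 0 * numberOp x 1 := by
  rw [← orbitalPhaseAut_apply hg, map_sub, map_sum, map_sum]
  congr 1
  · refine Finset.sum_congr rfl fun x _ => ?_
    rw [orbitalPhaseAut_apply hg, orbitalPhase_conj_numberOp hg]
  · refine Finset.sum_congr rfl fun x _ => ?_
    rw [map_mul, orbitalPhaseAut_apply hg, orbitalPhaseAut_apply hg, orbitalPhase_conj_numberOp hg,
      orbitalPhase_conj_numberOp hg]

/-- **The Shiba transformation of the Hubbard Hamiltonian** (Lieb 1989, proof of Thm 2; Shiba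
1972): with `S = orbitalPhase g · partialParticleHole D↓`, `g = 1` on up orbitals and
`g(x↓) g(y↓)* = -1` on every bond of `G` (a bipartite gauge on the down spins),
`S H(t, U) Sᴴ = H(t, -U) + U N↑` — the repulsive model is unitarily the attractive model plus the
conserved one-body term `U N↑`. [cite: Lieb1989, proof of Theorem 2] -/
theorem shiba_conj_hamiltonian {g : Orb Λ → ℂ} (hg : ∀ i, ‖g i‖ = 1) (hg0 : ∀ x, g (orb x 0) = 1)
    (hg1 : ∀ x y, G.Adj x y → g (orb x 1) * star (g (orb y 1)) = -1) (t U : ℝ) :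
    orbitalPhase g * partialParticleHole (spinDownOrbitals : Finset (Orb Λ)) * hamiltonian G t U *
        (orbitalPhase g * partialParticleHole (spinDownOrbitals : Finset (Orb Λ)))ᴴ =
      hamiltonian G t (-U) + (U : ℂ) • ∑ x : Λ, numberOp x 0 := by
  set W : Matrix (Finset (Orb Λ)) (Finset (Orb Λ)) ℂ := partialParticleHole spinDownOrbitals with hW
  set V : Matrix (Finset (Orb Λ)) (Finset (Orb Λ)) ℂ := orbitalPhase g with hV
  -- step 1: the down-spin particle–hole exchange
  have h1 : W * hamiltonian G t U * Wᴴ =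
      -(t : ℂ) • (∑ x : Λ, ∑ y : Λ, if G.Adj x y then
        creation (orb x 0) * annihilation (orb y 0) - creation (orb y 1) * annihilation (orb x 1) else 0) +
      (U : ℂ) • ((∑ x : Λ, numberOp x 0) - ∑ x : Λ, numberOp x 0 * numberOp x 1) := by
    rw [hamiltonian, Matrix.mul_add, Matrix.add_mul, Matrix.mul_smul, Matrix.smul_mul, Matrix.mul_smul,
      Matrix.smul_mul, hW, partialParticleHole_conj_hopping, partialParticleHole_conj_onSiteRepulsion]
  -- step 2: the bipartite gauge
  rw [conjTranspose_mul, show V * W * hamiltonian G t U * (Wᴴ * Vᴴ) = V * (W * hamiltonian G t U * Wᴴ) * Vᴴ by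
    simp only [Matrix.mul_assoc], h1, Matrix.mul_add, Matrix.add_mul, Matrix.mul_smul, Matrix.smul_mul,
    Matrix.mul_smul, Matrix.smul_mul, hV, orbitalPhase_conj_flippedHopping G hg hg0 hg1,
    orbitalPhase_conj_numberUp_sub_onSite hg, hamiltonian, Complex.ofReal_neg, neg_smul, smul_sub]
  module

/-- **Registered sub-goal form of the Shiba operator identity** (binder-free restatement of
`shiba_conj_hamiltonian`, the signature registered on stmt-HubbardSuperconductivity-1176):
for every finite graph with a bipartite down-spin gauge `g`, `S H(t,U) Sᴴ = H(t,-U) + U N↑`.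
[cite: Lieb1989, proof of Theorem 2] -/
theorem shiba_operator_identity : ∀ {Λ : Type*} [LinearOrder Λ] [Fintype Λ] (G : SimpleGraph Λ) [DecidableRel G.Adj] (g : Orb Λ → ℂ), (∀ i, ‖g i‖ = 1) → (∀ x, g (orb x 0) = 1) → (∀ x y, G.Adj x y → g (orb x 1) * star (g (orb y 1)) = -1) → ∀ t U : ℝ, orbitalPhase g * partialParticleHole (spinDownOrbitals : Finset (Orb Λ)) * hamiltonian G t U * (orbitalPhase g * partialParticleHole (spinDownOrbitals : Finset (Orb Λ)))ᴴ = hamiltonian G t (-U) + (U : ℂ) • ∑ x : Λ, numberOp x 0 :=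
  fun G _ _ hg hg0 hg1 t U => shiba_conj_hamiltonian G hg hg0 hg1 t U

end Operator

end Summit.HubbardSuperconductivity.HubbardSuperconductivity.Theorems.CooperPairDMottWalk

end
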